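import Summits.Langlands.Langlands.Theorems.SoloInformedFontaineMazurGL1General
import Literature.NumberTheory.PAdicHodge.LubinTateCharacterConjugatesTotallyRamified
import HarnessLib

/-!
# SoloInformedDeRhamGL1TotallyRamified — de Rham ⇒ locally algebraic for rank-one `p`-adic
# representations of `Γ_F`, for EVERY totally ramified `F/ℚ_p`, `p ≥ 3` (solo-Langlands-informed s112, Stage E)

`SoloInformedFontaineMazurGL1General.exists_isOpen_eq_prod_of_isDeRhamFramed_general` proves Tate's
theorem (de Rham ⇒ locally algebraic, rank one) for every finite `F/ℚ_p` GRANTING the Literature hypothesis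
(H) = `LubinTateCharacterConjugateAdmissible F p hp hπ` (the conjugates `e ∘ χ_π`, `e ≠ id`, of the Lubin–Tate
character have Hodge–Tate weight `0`).  The Literature theorem
`lubinTateCharacterConjugateAdmissible_of_totallyRamified` (s112: conjugate specialisation `θ_ρ` of Fontaine's
element of the `π`-division tower + Lang's limit — no `B_dR`, every degree) DISCHARGES (H) whenever `F/ℚ_p` is
totally ramified (`[F : ℚ_p] = deg f` for an Eisenstein datum `D = (f, π)` of `F` whose root `π` is the
uniformizer, `#k_F = p`) and `p ≥ 3`.  Hence:

★ `exists_isOpen_eq_prod_of_isDeRhamFramed_totallyRamified` — for such `F`, every de Rham framed character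
`r : Γ_F → GL₁(ℚ̄_p)` is locally algebraic: `r(w) = ∏_e e(Art_F w)^{n_e}` on an open subgroup of inertia.
This supersedes `SoloInformedDeRhamGL1QuadraticRamified` (`[F : ℚ_p] = 2`) and is the rank-one
local-algebraicity theorem for all totally ramified `p`-adic fields, `p` odd; the residue-degree `f ≥ 2` case
remains conditional on (H).

References: J.-P. Serre, *Abelian ℓ-adic representations and elliptic curves* (1968), Ch. III App. A
[SerreAbelianLadic1968]; J. Tate, *p-divisible groups* (1967), §3.3 [Tate1967]; P. Colmez, Ann. of
Math. 138 (1993) §I.2 [Colmez1993]; S. Lang, *Cyclotomic Fields I and II* (1990), Ch. 8 §6 [LangCyclotomic1990].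
-/

noncomputable section

open ValuativeRel
open scoped MatrixGroups

namespace Summit.Langlands.Langlands.Theorems

open Literature.NumberTheory.PAdicHodge
open Literature.NumberTheory.GaloisRepresentations
open Literature.NumberTheory.GaloisRepresentations.IsNonarchimedeanLocalField
open Literature.NumberTheory.LocalFields
open Field

/-- ★ **Tate's theorem (de Rham ⇒ locally algebraic) for rank one over every totally ramified `F/ℚ_p`,
`p ≥ 3` — unconditionally.** Hypotheses: an Eisenstein datum `D` of `F` whose root is the uniformizer `π`,
`#k_F = p`, `[F : ℚ_p] = deg f = e`.
[cite: SerreAbelianLadic1968, Ch. III §A.5–A.7] [cite: Tate1967, §3.3 Thm. 2 and Cor. 2] [cite: Colmez1993, §I.2] -/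
theorem exists_isOpen_eq_prod_of_isDeRhamFramed_totallyRamified
    {F : Type} [Field F] [ValuativeRel F] [TopologicalSpace F] [IsNonarchimedeanLocalField F]
    [CharZero F] {p : ℕ} [Fact p.Prime] (hp : valuation F p < 1) (D : EisensteinRoot F p hp)
    {π : 𝒪[F]} (hπ : (valuation F).IsUniformizer (π : F)) (hπD : (π : F) = D.root)
    (hk : residueFieldCard F = p) (hp3 : 3 ≤ p) (hd : Module.finrank (PadicBase F p hp) F = D.e)
    (r : FramedRep (absoluteGaloisGroup F) (PadicAlgCl p) 1)
    (hr : (fontainePst F p hp).IsDeRhamFramed r) :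
    ∃ V : Subgroup Fˣ, IsOpen (V : Set Fˣ) ∧
      ∃ (s : Finset (F →+* PadicAlgCl p)) (n : (F →+* PadicAlgCl p) → ℤ),
        (∀ e ∈ s, Continuous e) ∧ ∀ w ∈ WeilGroup.inertia F, canonicalArtin F w ∈ V →
          ((r (WeilGroup.toAbsGalois F w) : GL (Fin 1) (PadicAlgCl p)) :
              Matrix (Fin 1) (Fin 1) (PadicAlgCl p)) 0 0 =
            ∏ e ∈ s, e ((canonicalArtin F w : Fˣ) : F) ^ n e :=
  exists_isOpen_eq_prod_of_isDeRhamFramed_general hp hπ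
    (lubinTateCharacterConjugateAdmissible_of_totallyRamified D hπ hπD hk hp3 hd) r hr

/-- The hypothesis (H) of the `GL₁` files, discharged for totally ramified `F` (re-export under the summit
namespace, for the assembly files). [cite: SerreAbelianLadic1968, Ch. III §A.5] [cite: Colmez1993, §I.2] -/
theorem lubinTateCharacterConjugateAdmissible_totallyRamified
    {F : Type} [Field F] [ValuativeRel F] [TopologicalSpace F] [IsNonarchimedeanLocalField F]
    [CharZero F] {p : ℕ} [Fact p.Prime] (hp : valuation F p < 1) (D : EisensteinRoot F p hp)
    {π : 𝒪[F]} (hπ : (valuation F).IsUniformizer (π : F)) (hπD : (π : F) = D.root)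
    (hk : residueFieldCard F = p) (hp3 : 3 ≤ p) (hd : Module.finrank (PadicBase F p hp) F = D.e) :
    LubinTateCharacterConjugateAdmissible F p hp hπ :=
  lubinTateCharacterConjugateAdmissible_of_totallyRamified D hπ hπD hk hp3 hd

end Summit.Langlands.Langlands.Theorems

end
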